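import Summits.ValiantsHypothesis.ValiantsHypothesis.Theorems.LacunarySymmetroidMatrixDescartesFiniteSectorRealisableFiveFour
import Summits.ValiantsHypothesis.ValiantsHypothesis.Theorems.LacunarySymmetroidMatrixDescartesFiniteSectorEtaTwoSix
import Summits.ValiantsHypothesis.ValiantsHypothesis.Theorems.LacunarySymmetroidMatrixDescartesFiniteSectorSectorCeilingFiveFour
import Summits.ValiantsHypothesis.ValiantsHypothesis.Theorems.LacunarySymmetroidMatrixDescartesFiniteSectorStampCeilingFiveFour

/-!
# `MatrixDescartes` — line «finite»: the `(5,4)` cell is EXACT on both sides in both currencies: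
# `ν(5,4) = 35` and `η(5,4) = 70` (by name)

HONEST FRAMING.  Object-search cell `pub-symmetroid`, seat val-sym-eng-3 g6 (census/instrument engine #3).  HELPER of
the crux item `stmt-ValiantsHypothesis-18050` (`Theses.LacunarySymmetroid.MatrixDescartes`, asymptotic in `K`) with NO
closure claim — register bookkeeping only, in the pattern of `…FiniteSectorEtaSixThree` / `…FiniteSectorEtaSevenThree`.
The seat's witness `fullyRealisable_five_0167_thirtyfive` (`…FiniteSectorRealisableFiveFour`: a symmetric `5 × 5`
half-pencil on the extremal basis `(0,1,6,7)` — a lifted twin-allowed symmetric tropical design — with a full-positive-rooted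
determinant of degree `35`) is read against the kernel ceilings of the `(5,4)` cell (door-p5 g8):

* stamp currency: `stampLawAt_five_four : StampLawAt 5 4 35` (`…FiniteSectorStampCeilingFiveFour`) and, here,
  `not_stampLawAt_five_four_34 : ¬ StampLawAt 5 4 34` — so **`ν(5,4) = 35 = n(5,3)`** exactly;
* sector currency: `hypRootLawAt_five_four_70 : HypRootLawAt 5 4 70` (`…FiniteSectorSectorCeilingFiveFour`) and, here,
  `not_hypRootLawAt_five_four_69 : ¬ HypRootLawAt 5 4 69` by the PROVED doubling `u ↦ u²` (adapter
  `not_hypRootLawAt_of_fullyRealisable`, T2: an in-sector `(5,4)` pencil on `(0,2,12,14)` of degree `70`) — so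
  **`η(5,4) = 70 = σ(5,4)`** exactly.

Nothing here bears on the crux or on `VP ≠ VNP`.  [folklore] Descartes / postage-stamp bookkeeping; no citation exists or is
needed.
-/

-- `Summit.ValiantsHypothesis.ValiantsHypothesis.…` repeats a component by the D-0017 layout
-- (single-conjunct summit), which the `dupNamespace` linter flags; the name is mandated.
set_option linter.dupNamespace false

namespace Summit.ValiantsHypothesis.ValiantsHypothesis.Theorems.LacunarySymmetroidMatrixDescartes.FiniteSector

/-- **`ν(5,4) = 35` is EXACT: the ceiling `34` fails** (witness `fullyRealisable_five_0167_thirtyfive` on `(0,1,6,7)`).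
[folklore] -/
theorem not_stampLawAt_five_four_34 : ¬ StampLawAt 5 4 34 := by
  intro h
  obtain ⟨S, hS, hfull, hdeg⟩ := fullyRealisable_five_0167_thirtyfive
  have := h _ S hS hfull
  omega

/-- **`ν(5,4) = 35` EXACT on both sides** (`n(5,3) = 35`: ceiling `stampLawAt_five_four`, floor
`not_stampLawAt_five_four_34`). [folklore] -/
theorem nu_five_four_exact : StampLawAt 5 4 35 ∧ ¬ StampLawAt 5 4 34 :=
  ⟨stampLawAt_five_four, not_stampLawAt_five_four_34⟩

/-- **`η(5,4) ≥ 70`**: `¬ HypRootLawAt 5 4 69` — the doubled `(5,4)` realisation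
(`fullyRealisable_five_0167_thirtyfive`): an in-sector (all roots real and simple) symmetric `(5,4)` pencil on `(0,2,12,14)`
of degree `70` (adapter `not_hypRootLawAt_of_fullyRealisable`, T2). [folklore] -/
theorem not_hypRootLawAt_five_four_69 : ¬ HypRootLawAt 5 4 69 :=
  not_hypRootLawAt_of_fullyRealisable fullyRealisable_five_0167_thirtyfive (by norm_num)

/-- **`η(5,4) = 70` EXACT on both sides** (`σ(5,4) = 70 = 2·n(5,3)`: ceiling `hypRootLawAt_five_four_70`, floor
`not_hypRootLawAt_five_four_69`). [folklore] -/
theorem eta_five_four_exact : HypRootLawAt 5 4 70 ∧ ¬ HypRootLawAt 5 4 69 :=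
  ⟨hypRootLawAt_five_four_70, not_hypRootLawAt_five_four_69⟩

end Summit.ValiantsHypothesis.ValiantsHypothesis.Theorems.LacunarySymmetroidMatrixDescartes.FiniteSector
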